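/-
Copyright (c) 2026 the pub-hodgecm-mathlib formalisation cell (harness21).  Prover seat hodgecm-mathlib-F0P3a-p02 (g23): the θ̄ = 1 EXPORT of LAYER C (C5)′
(CENSUS-C5-InertCountsValuesTrace bd72510a §3∕§6, LH3-p02 (g6); LH4-plan (g7) WORD #15 (D3) + (R-ord) WORD #26), 2026-09-02.
-/
import Literature.NumberTheory.Rogawski1990.UnitOrbitalIntegralInertValueThetaOneCornerTrace    -- ★ p852253 (this seat): the θ̄ = 1 CornerTrace head `natCard_fixedPoints_unitaryInt_traceTorusPi_eq_phiOne_of_forall_mul_map_ne`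
import Literature.NumberTheory.Rogawski1990.UnitOrbitalIntegralInertValueThetaOneAdicCompletion    -- ★ the Flicker-frame sibling: its seven 2-free ★ suppliers and carriers
import Literature.NumberTheory.Automorphic.HyperspecialUnitaryCartanAdicCompletion               -- ★ `unramifiedLocalConjDatum_adicCompletion`
import HarnessLib

/-!
# The `θ̄ = 1` value AT THE INERT COMPLETION `L_w` for TRACE literals, every residue characteristic:
# `#Fix_{U(L_w)⧸K}(t_π^{(b)}(x₁,x₂,x₃)) = φ₁(N₁, N)` with `q = Nv` (Flicker 1998 Prop. 11; Rogawski 1990 §4.9; Kottwitz 1986 §3)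

Topic `NumberTheory/Rogawski1990`; namespace `Literature.NumberTheory.Automorphic.UnitaryGroup` (as the ★ sibling).  THEOREMS ONLY (no definition, no instance, no
notation, no named fact); kernel lane `--supports stmt-HodgeConjecture-24833`.  Cell `pub/hodgecm-mathlib`, crux H413; LH4 board (D-UNR), LAYER C (C5)′: the θ̄ = 1
EXPORT file of CENSUS-C5-InertCountsValuesTrace (LH3-p02 (g6), sha16 bd72510a61456e21, §3 + §6; LH4-plan (g7) WORD #15 (D3), binder order of record (R-ord) WORD #26),
the `|2|`-free twin of ★ `UnitOrbitalIntegralInertValueThetaOneAdicCompletion` (A-p03 (g25)).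

WHAT.  ★ `natCard_fixedPoints_unitaryInt_corner_eq_phiOne_adicCompletion` discharges, at `K = L_w` (`w ∣ v` inert, `v` unramified), the local frame data of the θ̄ = 1
corner count ★ `natCard_fixedPoints_unitaryInt_corner_eq_phiOne_of_forall_mul_map_ne` (Flicker's scalar `π`: any `σ_w`-fixed non-norm, `ππ′ = 1`) — with `h2 : 2 ∉ v`
(★ `localConjDatum_adicCompletion`), Flicker's corner scalar `y σy = −2` and the `e = ½` literal.  Here the corner count is the TRACE corner count
`natCard_fixedPoints_unitaryInt_traceTorusPi_eq_phiOne_of_forall_mul_map_ne` of (C5)′ `…ValueThetaOneCornerTrace` (SIGFIRST-CornerTrace 06a69e19d20bb0ae, LH3-p02 (g6):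
`(hd : UnramifiedLocalConjDatum σ ϖ) (h2 : (2 : K) ≠ 0)`, `{y} hy`∕`{e} h2e` DELETED, `{b} (hb) (hbv) (hbδ)` + `{x₁ x₂ x₃ π π'} (hx₁) (hx₂) (hx₃) (hσπ) (hππ') (hπN)`,
literal = F1 `M_π(x₁,x₂,x₃) = !![x₁σb + x₃b, 0, π(x₁ − x₃); 0, x₂, 0; π′bσb(x₁ − x₃), 0, x₁b + x₃σb]`, exponents ∕ `hfin` ∕ conclusion VERBATIM; FINDING #18: if that
head lands split `hE∕hE0`, STAGE 2 combines the two by `by_cases`), and the discharge is ★'s recipe with `localConjDatum_adicCompletion … h2 ↦ unramifiedLocalConjDatum_adicCompletion …`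
(★ `HyperspecialUnitaryCartanAdicCompletion` :201, every residue characteristic) and `h2 : (2 : L_w) ≠ 0` from characteristic zero; the `ValuativeRel` ↔ `Valued`
currency bridge, `|𝓀_w| = q²` (★ `natCard_residueField_eq_sq_of_inert`), `σ_w(𝒪) ⊆ 𝒪` (★ `mem_integer_galAdicCompletionMap`) and the generator `a₀` with
`σa₀ − a₀ ∈ 𝒪^×` (★ `exists_isUnit_map_sub_of_residueHom_ne` ∘ ★ `exists_frob_ne` ∘ ★ `residueHom_galAdicCompletionMap_eq_pow`) are VERBATIM (all `|2|`-free).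

* **`natCard_fixedPoints_unitaryInt_traceTorusPi_eq_phiOne_adicCompletion`** — binder order of record (R-ord): `(w)(hw)[IsAdicComplete](hv){b}(hb)(hbv)(hbδ)
  {x₁ x₂ x₃ π π'}(hx₁)(hx₂)(hx₃)(hσπ)(hππ')(hπN){t}(hte){N N₁ N₂}(hN)(hN₁)(hN₂)(hfin)`; conclusion `= phiOne (Ideal.absNorm v.asIdeal) N₁ N` VERBATIM.  Consumers:
  (C6)-4 ★ p851982 `ncard_rankStratum_zero_eq_phiOne_of_congr_traceTorusEltPi_of_count` (`hX₁`), (C6)-5 `sum_ncard_rankStrata_eq_phiOne_of_congr_traceTorusEltPi`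
  (LH3-p01), the unit-FL value twins `UnitFundamentalLemmaInertSplitValue{One,ThetaOne,sThetaOne}`.
HONEST LABEL: HC_CM is proved only modulo the 7 printed citations (2 remaining: hLiu418 = stmt-HodgeConjecture-24832, h413 = stmt-HodgeConjecture-24833) until rung 0
closes; count-neutral ((D-UNR) PRINT by D74′); pays no organ, opens no road.

## References
* [Flicker1998UnitaryFL] Y. Z. Flicker, *Elementary proof of the fundamental lemma for a unitary group*, Canad. J. Math. 50 (1998), Prop. 3 p. 79, Prop. 11 p. 87,
  Props. 12–13 pp. 89–94.
* [Rogawski1990] J. D. Rogawski, *Automorphic Representations of Unitary Groups in Three Variables* (1990), §4.9 Prop. 4.9.1 (b) p. 55.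
* [Kottwitz1986] R. E. Kottwitz, *Base change for unit elements of Hecke algebras*, Compositio Math. 60 (1986), §3.
* [SerreLocalFields1979] J.-P. Serre, *Local Fields* (1979), Ch. V §2 Prop. 3 (trace surjective in unramified extensions).
-/

set_option autoImplicit false

open scoped MatrixGroups WithZero Valued
open Matrix NumberField IsDedekindDomain

namespace Literature.NumberTheory.Automorphic

namespace UnitaryGroup

open Literature.NumberTheory.Automorphic.HermitianLattice (unitaryInt mem_unitaryInt_iff UnramifiedLocalConjDatum)
open Literature.NumberTheory.Rogawski1990.Flicker1998 (phiOne)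
open IsLocalRing

/-! ## §1 The θ̄ = 1 EXPORT at the inert completion `L_w` -/

section AdicCompletion

variable (L : Type) [Field L] [NumberField L] [IsCMField L] {v : HeightOneSpectrum (𝓞 ↥(maximalRealSubfield L))}

set_option synthInstance.maxHeartbeats 200000 in
-- the `U_w`-action on `U_w ⧸ unitaryInt` (as the ★ sibling)
/-- **`#Fix_{U(L_w)⧸K}(t_π^{(b)}(x₁,x₂,x₃)) = φ₁(N₁,N)` at an inert UNRAMIFIED place, `q = Nv`, EVERY residue characteristic** (frame data discharged; the trace element
`b` with `b + σ_w b = 1`, `|b|_w ≤ 1`, `|σ_w b − b|_w = 1` and the σ_w-fixed non-norm `π`, `ππ′ = 1`, are the caller's).  ONE INSTANCE BINDER is carried, as in ★: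
`[IsAdicComplete 𝓂[𝒪_w] 𝒪_w]`.  Twin of ★ `natCard_fixedPoints_unitaryInt_corner_eq_phiOne_adicCompletion` with `h2 {y} hy {e} h2e` DELETED, `{b} (hb) (hbv) (hbδ)`
ADDED, eigenvalues `{a b cc} ↦ {x₁ x₂ x₃}`, literal = the θ̄ = 1 trace literal; binder order (R-ord) of record.
[cite: Flicker1998UnitaryFL, Prop. 11 p. 87] [cite: Rogawski1990, §4.9 Prop. 4.9.1 (b) p. 55] [cite: Kottwitz1986, §3] -/
theorem natCard_fixedPoints_unitaryInt_traceTorusPi_eq_phiOne_adicCompletion (w : PlacesOver L v) (hw : IsCMField.complexConj L • w.1 = w.1)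
    [IsAdicComplete (IsLocalRing.maximalIdeal 𝒪[w.1.adicCompletion L]) 𝒪[w.1.adicCompletion L]]
    (hv : Algebra.IsUnramifiedIn (𝓞 L) v.asIdeal)
    {b : w.1.adicCompletion L} (hb : b + galAdicCompletionMap (L := L) (IsCMField.complexConj L) hw b = 1) (hbv : Valued.v b ≤ 1)
    (hbδ : Valued.v (galAdicCompletionMap (L := L) (IsCMField.complexConj L) hw b - b) = 1)
    {x₁ x₂ x₃ π π' : w.1.adicCompletion L} (hx₁ : galAdicCompletionMap (L := L) (IsCMField.complexConj L) hw x₁ * x₁ = 1)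
    (hx₂ : galAdicCompletionMap (L := L) (IsCMField.complexConj L) hw x₂ * x₂ = 1) (hx₃ : galAdicCompletionMap (L := L) (IsCMField.complexConj L) hw x₃ * x₃ = 1)
    (hσπ : galAdicCompletionMap (L := L) (IsCMField.complexConj L) hw π = π) (hππ' : π * π' = 1)
    (hπN : ∀ z : w.1.adicCompletion L, galAdicCompletionMap (L := L) (IsCMField.complexConj L) hw z * z ≠ π)
    {t : ↥(unitaryGroupOfForm (galAdicCompletionMap (L := L) (IsCMField.complexConj L) hw)
      (placeForm (Matrix.of fun i j : Fin 3 => if i.val + j.val + 1 = 3 then (1 : L) else 0) w.1))}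
    (hte : ((t : GL (Fin 3) (w.1.adicCompletion L)) : Matrix (Fin 3) (Fin 3) (w.1.adicCompletion L)) =
      !![x₁ * galAdicCompletionMap (L := L) (IsCMField.complexConj L) hw b + x₃ * b, 0, π * (x₁ - x₃); 0, x₂, 0;
        π' * (b * galAdicCompletionMap (L := L) (IsCMField.complexConj L) hw b * (x₁ - x₃)), 0,
        x₁ * b + x₃ * galAdicCompletionMap (L := L) (IsCMField.complexConj L) hw b])
    {N N₁ N₂ : ℕ} (hN : Valued.v (x₁ - x₃) = WithZero.exp (-(N : ℤ))) (hN₁ : Valued.v (x₁ - x₂) = WithZero.exp (-(N₁ : ℤ)))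
    (hN₂ : Valued.v (x₃ - x₂) = WithZero.exp (-(N₂ : ℤ)))
    (hfin : {x : ↥(unitaryGroupOfForm (galAdicCompletionMap (L := L) (IsCMField.complexConj L) hw)
        (placeForm (Matrix.of fun i j : Fin 3 => if i.val + j.val + 1 = 3 then (1 : L) else 0) w.1)) ⧸
      unitaryInt (galAdicCompletionMap (L := L) (IsCMField.complexConj L) hw)
        (placeForm (Matrix.of fun i j : Fin 3 => if i.val + j.val + 1 = 3 then (1 : L) else 0) w.1) | t • x = x}.Finite) :
    (Nat.card {x : ↥(unitaryGroupOfForm (galAdicCompletionMap (L := L) (IsCMField.complexConj L) hw)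
        (placeForm (Matrix.of fun i j : Fin 3 => if i.val + j.val + 1 = 3 then (1 : L) else 0) w.1)) ⧸
      unitaryInt (galAdicCompletionMap (L := L) (IsCMField.complexConj L) hw)
        (placeForm (Matrix.of fun i j : Fin 3 => if i.val + j.val + 1 = 3 then (1 : L) else 0) w.1) | t • x = x} : ℚ) =
      phiOne (Ideal.absNorm v.asIdeal) N₁ N := by
  classical
  have hc1 : IsCMField.complexConj L ≠ 1 := IsCMField.complexConj_ne_one L
  -- `J_w` is the antidiagonal form over `L_w`
  have hJ : placeForm (Matrix.of fun i j : Fin 3 => if i.val + j.val + 1 = 3 then (1 : L) else 0) w.1 =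
      (StdForm.antidiagonal 3).over (w.1.adicCompletion L) := by
    rw [placeForm, antidiagOne_eq_over, StdForm.over_map]
  -- the UNRAMIFIED local conjugation datum (every residue characteristic), `2 ≠ 0` in characteristic zero
  obtain ⟨ϖ, hd⟩ := unramifiedLocalConjDatum_adicCompletion (IsCMField.complexConj L) hc1 v w hw hv
  have h2 : (2 : w.1.adicCompletion L) ≠ 0 := two_ne_zero
  -- THE CURRENCY BRIDGE: the `ValuativeRel` integers (home of ★ `mem_integer_galAdicCompletionMap`, ★ `natCard_residueField_eq_sq_of_inert`,
  -- ★ `exists_isUnit_map_sub_of_residueHom_ne`) and the `Valued` integers `𝒪[L_w]` of the corner count are the same subring of `L_w`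
  have hO : (ValuativeRel.valuation (w.1.adicCompletion L)).integer = 𝒪[w.1.adicCompletion L] := by
    rw [integer_valuation_eq_adicCompletionIntegers]
    ext x
    simp only [ValuationSubring.mem_toSubring, HeightOneSpectrum.mem_adicCompletionIntegers, Valued.integer, Valuation.mem_integer_iff]
  have hmem : ∀ x : w.1.adicCompletion L, x ∈ (ValuativeRel.valuation (w.1.adicCompletion L)).integer ↔ x ∈ 𝒪[w.1.adicCompletion L] :=
    fun x => by rw [hO]
  let eO : ↥(ValuativeRel.valuation (w.1.adicCompletion L)).integer ≃+* ↥𝒪[w.1.adicCompletion L] := RingEquiv.subringCongr hO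
  have hσO' : ∀ x : ↥(ValuativeRel.valuation (w.1.adicCompletion L)).integer,
      galAdicCompletionMap (L := L) (IsCMField.complexConj L) hw x ∈ (ValuativeRel.valuation (w.1.adicCompletion L)).integer :=
    mem_integer_galAdicCompletionMap (IsCMField.complexConj L) v w hw
  have hσO : ∀ x : 𝒪[w.1.adicCompletion L], galAdicCompletionMap (L := L) (IsCMField.complexConj L) hw x ∈ 𝒪[w.1.adicCompletion L] :=
    fun x => (hmem _).1 (hσO' ⟨x, (hmem _).2 x.2⟩)
  let σR : ↥(ValuativeRel.valuation (w.1.adicCompletion L)).integer →+* ↥(ValuativeRel.valuation (w.1.adicCompletion L)).integer :=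
    ((galAdicCompletionMap (L := L) (IsCMField.complexConj L) hw).comp (ValuativeRel.valuation (w.1.adicCompletion L)).integer.subtype).codRestrict
      (ValuativeRel.valuation (w.1.adicCompletion L)).integer fun x => hσO' x
  let σO : 𝒪[w.1.adicCompletion L] →+* 𝒪[w.1.adicCompletion L] :=
    ((galAdicCompletionMap (L := L) (IsCMField.complexConj L) hw).comp (𝒪[w.1.adicCompletion L]).subtype).codRestrict 𝒪[w.1.adicCompletion L] fun x => hσO x
  -- `|𝓀_w| = q²` (counted in the `ValuativeRel` presentation, moved by `eO`)
  have hqR := natCard_residueField_eq_sq_of_inert (IsCMField.complexConj L) v hc1 hv w hw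
  have hq : Nat.card (ResidueField 𝒪[w.1.adicCompletion L]) = Ideal.absNorm v.asIdeal ^ 2 := by
    rw [← Nat.card_congr (IsLocalRing.ResidueField.mapEquiv eO).toEquiv, hqR, Ideal.absNorm_apply, Submodule.cardQuot_apply]
  -- an integer moved by a unit (found in the `ValuativeRel` presentation, moved by `eO`)
  obtain ⟨σk, hσk⟩ := exists_residueField_ringHom_galAdicCompletionMap (IsCMField.complexConj L) v w hw
  letI : Fintype (ResidueField ↥(ValuativeRel.valuation (w.1.adicCompletion L)).integer) := Fintype.ofFinite _
  have hq' : Fintype.card (ResidueField ↥(ValuativeRel.valuation (w.1.adicCompletion L)).integer) = Nat.card (𝓞 ↥(maximalRealSubfield L) ⧸ v.asIdeal) ^ 2 := by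
    rw [← Nat.card_eq_fintype_card, hqR]
  obtain ⟨a₀, ha₀⟩ := LocalFields.UnramifiedQuadraticNorm.exists_isUnit_map_sub_of_residueHom_ne
    (galAdicCompletionMap (L := L) (IsCMField.complexConj L) hw) (fun x => hσO' x) σk hσk
    (Literature.LinearAlgebra.Matrix.exists_frob_ne hq' σk
      (residueHom_galAdicCompletionMap_eq_pow (IsCMField.complexConj L) v hc1 hv w hw σk (fun x => hσO' x) hσk))
  have ha₀' : IsUnit (σO (eO a₀) - eO a₀) := by
    have h := (ha₀ : IsUnit (σR a₀ - a₀)).map eO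
    rw [map_sub] at h
    convert h using 2
    exact Subtype.ext rfl
  exact natCard_fixedPoints_unitaryInt_traceTorusPi_eq_phiOne_of_forall_mul_map_ne (galAdicCompletionMap (L := L) (IsCMField.complexConj L) hw) hJ hd h2
    (fun x => hσO x) hq (a₀ := eO a₀) ha₀' hb hbv hbδ hx₁ hx₂ hx₃ hσπ hππ' hπN hte hN hN₁ hN₂ hfin

end AdicCompletion

end UnitaryGroup

end Literature.NumberTheory.Automorphic
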